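import Literature.Geometry.Symplectic.OrigamiFoldDefiningFunction
import Literature.Geometry.Symplectic.OrigamiFoldKernelField
import Literature.Geometry.Symplectic.OrigamiFoldCollar
import HarnessLib

/-!
# The kernel-adapted collar data of the fold of a folded / origami form (step (S1a) assembled)

Proofs companion of `OrigamiUnfolding.lean` (the named fact
`Literature.Geometry.Symplectic.exists_symplecticCutPieces_of_isOrigamiForm`, Cannas da
Silva–Guillemin–Pires, *Symplectic Origami*, IMRN 2011 = arXiv:0909.4065, Prop. 2.8; architecture
in `OrigamiUnfoldingProofs.lean`, steps (S0)–(S4)).  This file only ASSEMBLES the three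
preceding ones into the statement from which step (S1b) (first-order coefficient, rescaling,
normalisation of the collar) proceeds:

* `OrigamiFoldDefiningFunction.lean` — the fold is the regular zero level of a smooth `f` with
  the sides as signs and `ker df = TZ` along the fold;
* `OrigamiFoldKernelField.lean` — a unit field `U : LevelUnitField 3 f 0` across a band of the
  fold whose vectors along the fold lie in `ker ω`;
* `OrigamiFoldCollar.lean` — the flow-out `foldCollar U j (n, t) = U.fl (j n) t` is a
  diffeomorphism of `N × (-δ, δ)` onto the band `f⁻¹(-δ, δ)`, and the pulled-back form `c^*ω`
  is smooth, closed, non-degenerate off `t = 0`, and equal to `pr^* j^*ω` with no `dt`-component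
  on `N × {0}` when the field is kernel-adapted.

Results: `IsFoldedForm.exists_kernelAdapted_collarData` (defining function + kernel-adapted unit
field), **`IsFoldedForm.exists_kernelAdaptedCollar`** (the full package: `f`, `U` and all the
properties of `c = foldCollar U j` and of `c^*ω` listed above), and the `IsOrigamiForm` versions
(`IsOrigamiForm.exists_kernelAdapted_collarData`, `IsOrigamiForm.exists_kernelAdaptedCollar`, for
an origami form on a compact orientable 4-manifold, with the fold data `(N, j, θ)` of
`IsOrigamiForm.exists_fold` exposed so that the circle action is available on the collar).

Everything here is proved; no definitions, no named facts (D-0026).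

## References

* [CannasdasilvaGuilleminPires2010] A. Cannas da Silva, V. Guillemin, A. R. Pires, *Symplectic
  Origami*, IMRN 2011, 4252–4293 = arXiv:0909.4065, Def. 2.1–2.2, Prop. 2.8 and its proof.
* A. Cannas da Silva, V. Guillemin, C. Woodward, *On the unfolding of folded symplectic
  structures*, Math. Res. Lett. 7 (2000) 35–53, Thm. 1 (the collar / Moser model of the fold).
-/

noncomputable section

open scoped Manifold ContDiff Topology
open Set Function Filter
open Literature.Geometry.Kaehler Literature.Topology.FourManifolds

namespace Literature.Geometry.Symplectic

universe u

variable {M : Type u} [TopologicalSpace M] [T2Space M] [CompactSpace M]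
  [ChartedSpace (EuclideanSpace ℝ (Fin 4)) M] [IsManifold (𝓡 4) ∞ M]
variable {N : Type} [TopologicalSpace N] [ChartedSpace (EuclideanSpace ℝ (Fin 3)) N]
  [IsManifold (𝓡 3) ∞ N] {j : N → M}

/-- **Kernel-adapted collar data of the fold.** For a folded form `ω` on a compact oriented
4-manifold there are a `C^∞` function `f` having the fold as regular zero level and the sides as
signs (`OrigamiFoldDefiningFunction.lean`), and a unit field `U : LevelUnitField 3 f 0` across a
band of the fold whose vectors along the fold lie in `ker ω` (`OrigamiFoldKernelField.lean`, fed
with `ker df = TZ`). [cite: CannasdasilvaGuilleminPires2010, Def. 2.1 and Prop. 2.8] -/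
theorem IsFoldedForm.exists_kernelAdapted_collarData {s : MForm (𝓡 4) M ℝ 2}
    (h : IsFoldedForm s N j) (o : SmoothOrientation (𝓡 4) M) :
    ∃ f : M → ℝ, IsRegularLevel (𝓡 4) f 0 ∧ f ⁻¹' {0} = fold s ∧
      {x | 0 < f x} = posSide o s ∧ {x | f x < 0} = posSide (-o) s ∧
      ∃ U : LevelUnitField 3 f 0, ∀ x ∈ fold s, ∀ w : TangentSpace (𝓡 4) x, s x ![U.ξ x, w] = 0 := by
  obtain ⟨f, hfs, hpos, hneg, hzero, hreg⟩ := h.exists_foldDefiningFunction o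
  have hf0 : ∀ x ∈ fold s, f x = 0 := fun x hx => (hzero x).2 hx
  have hfd : MDifferentiable (𝓡 4) 𝓘(ℝ, ℝ) f := hfs.mdifferentiable (by norm_num)
  have hker : ∀ (n : N) (v : TangentSpace (𝓡 4) (j n)), mfderiv (𝓡 4) 𝓘(ℝ, ℝ) f (j n) v = 0 →
      v ∈ Set.range (mfderiv (𝓡 3) (𝓡 4) j n) := by
    intro n v hv
    by_contra hvr
    have hn : mfderiv (𝓡 4) 𝓘(ℝ, ℝ) f (j n) ≠ 0 := hreg (j n) (h.range_eq ▸ mem_range_self n)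
    exact ((h.mfderiv_apply_ne_zero_iff hfd hf0 n hn v).2 hvr) hv
  obtain ⟨U, hU⟩ := h.exists_kernelAdapted_levelUnitField hfs (fun x hx => (hzero x).1 hx) hker
  refine ⟨f, ⟨hfs, fun x _ => BoundarylessManifold.isInteriorPoint, fun x hx => ?_⟩,
    Set.ext fun x => hzero x, Set.ext fun x => hpos x, Set.ext fun x => hneg x, U, hU⟩
  exact hreg x ((hzero x).1 hx)

/-- **The kernel-adapted collar of the fold** (step (S1a) of the unfolding assembled): for a
folded form `ω` with folding hypersurface `j : N ↪ M` on a compact oriented 4-manifold there are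
a defining function `f` of the fold (regular zero level, sides as signs) and a unit field `U`
across a band `f⁻¹[-δ, δ]` with `U.ξ ∈ ker ω` along the fold, such that the collar map
`c = foldCollar U j`, `c(n, t) = Fl^ξ_t(j n)`: is injective on `N × (-δ, δ)` with image the
band `f⁻¹(-δ, δ)`, satisfies `f (c(n,t)) = t`, has bijective differential there; and the
pulled-back form `c^*ω` is smooth, closed, non-degenerate at `(n, t)` for `0 < |t| < δ`, has no
`dt`-component on `N × {0}` and restricts there to `j^*ω`. [cite: CannasdasilvaGuilleminPires2010, Def. 2.1 and proof of Prop. 2.8] -/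
theorem IsFoldedForm.exists_kernelAdaptedCollar {s : MForm (𝓡 4) M ℝ 2}
    (h : IsFoldedForm s N j) (o : SmoothOrientation (𝓡 4) M) :
    ∃ (f : M → ℝ) (U : LevelUnitField 3 f 0),
      IsRegularLevel (𝓡 4) f 0 ∧ f ⁻¹' {0} = fold s ∧
      {x | 0 < f x} = posSide o s ∧ {x | f x < 0} = posSide (-o) s ∧
      (∀ x ∈ fold s, ∀ w : TangentSpace (𝓡 4) x, s x ![U.ξ x, w] = 0) ∧
      InjOn (foldCollar U j) (univ ×ˢ Ioo (-U.δ) U.δ) ∧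
      foldCollar U j '' (univ ×ˢ Ioo (-U.δ) U.δ) = f ⁻¹' Ioo (-U.δ) U.δ ∧
      (∀ (n : N) (t : ℝ), t ∈ Ioo (-U.δ) U.δ → f (foldCollar U j (n, t)) = t) ∧
      (∀ (n : N) (t : ℝ), t ∈ Ioo (-U.δ) U.δ →
        Bijective (mfderiv ((𝓡 3).prod 𝓘(ℝ, ℝ)) (𝓡 4) (foldCollar U j) (n, t))) ∧
      IsSmoothForm (s.pullback ((𝓡 3).prod 𝓘(ℝ, ℝ)) (foldCollar U j)) ∧
      IsClosedForm (s.pullback ((𝓡 3).prod 𝓘(ℝ, ℝ)) (foldCollar U j)) ∧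
      (∀ (n : N) (t : ℝ), t ∈ Ioo (-U.δ) U.δ → t ≠ 0 → ∀ V : EuclideanSpace ℝ (Fin 3) × ℝ, V ≠ 0 →
        ∃ W : EuclideanSpace ℝ (Fin 3) × ℝ,
          (s.pullback ((𝓡 3).prod 𝓘(ℝ, ℝ)) (foldCollar U j)) (n, t) ![V, W] ≠ 0) ∧
      (∀ (n : N) (W : EuclideanSpace ℝ (Fin 3) × ℝ),
        (s.pullback ((𝓡 3).prod 𝓘(ℝ, ℝ)) (foldCollar U j)) (n, 0)
          ![((0 : EuclideanSpace ℝ (Fin 3)), (1 : ℝ)), W] = 0) ∧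
      (∀ (n : N) (v v' : EuclideanSpace ℝ (Fin 3)),
        (s.pullback ((𝓡 3).prod 𝓘(ℝ, ℝ)) (foldCollar U j)) (n, 0) ![(v, (0 : ℝ)), (v', (0 : ℝ))] =
          (s.pullback (𝓡 3) j) n ![v, v']) := by
  obtain ⟨f, hreg, hzero, hpos, hneg, U, hU⟩ := h.exists_kernelAdapted_collarData o
  have hj : ContMDiff (𝓡 3) (𝓡 4) ∞ j := h.embedding.contMDiff
  have hj0 : ∀ n, f (j n) = 0 := fun n => by
    have : j n ∈ f ⁻¹' {0} := hzero ▸ (h.range_eq ▸ mem_range_self n)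
    exact this
  have hjr : range j = f ⁻¹' {0} := h.range_eq.trans hzero.symm
  have hzero' : ∀ x, x ∈ fold s → f x = 0 := fun x hx => by
    have : x ∈ f ⁻¹' {0} := hzero ▸ hx
    exact this
  have hUj : ∀ n, ∀ w : TangentSpace (𝓡 4) (j n), s (j n) ![U.ξ (j n), w] = 0 :=
    fun n w => hU (j n) (h.range_eq ▸ mem_range_self n) w
  exact ⟨f, U, hreg, hzero, hpos, hneg, hU,
    injOn_foldCollar U hj0 h.embedding.isEmbedding.injective,
    image_foldCollar U hjr,
    fun n t ht => apply_foldCollar U hj0 n ht,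
    fun n t ht => bijective_mfderiv_foldCollar U h.embedding hj0 n ht,
    isSmoothForm_pullback_foldCollar U hj h.smooth,
    isClosedForm_pullback_foldCollar U hj h.smooth h.closed,
    fun n t ht ht0 V hV => pullback_foldCollar_nondegenerate U h.embedding hj0 hzero' n ht ht0 V hV,
    fun n W => pullback_foldCollar_apply_inr U hj hUj n W,
    fun n v v' => pullback_foldCollar_apply_inl_inl U hj n v v'⟩

omit [IsManifold (𝓡 3) ∞ N] in
/-- The origami version of the collar data: on a compact orientable 4-manifold the fold of an
origami form has a defining function and a kernel-adapted unit field.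
[cite: CannasdasilvaGuilleminPires2010, Def. 2.2 and Prop. 2.8] -/
theorem IsOrigamiForm.exists_kernelAdapted_collarData {s : MForm (𝓡 4) M ℝ 2}
    (hs : IsOrigamiForm s) (o : SmoothOrientation (𝓡 4) M) :
    ∃ f : M → ℝ, IsRegularLevel (𝓡 4) f 0 ∧ f ⁻¹' {0} = fold s ∧
      {x | 0 < f x} = posSide o s ∧ {x | f x < 0} = posSide (-o) s ∧
      ∃ U : LevelUnitField 3 f 0, ∀ x ∈ fold s, ∀ w : TangentSpace (𝓡 4) x, s x ![U.ξ x, w] = 0 := by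
  obtain ⟨N', _, _, _, _, j', hf⟩ := hs.exists_isFoldedForm
  exact hf.exists_kernelAdapted_collarData o

omit [TopologicalSpace N] [ChartedSpace (EuclideanSpace ℝ (Fin 3)) N] [IsManifold (𝓡 3) ∞ N] in
/-- **The kernel-adapted collar of the fold of an origami form**, with the fold data exposed: on
a compact orientable 4-manifold, an origami form `ω` has compact fold data `(N, j, θ)` (embedded
folding hypersurface with its free null circle action, `IsOrigamiForm.exists_fold`) together with
a defining function `f` and a kernel-adapted unit field `U` as in
`IsFoldedForm.exists_kernelAdaptedCollar`; in particular the circle action is available on the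
collar `N × (-δ, δ)` (steps (S1b)–(S2) of the unfolding). [cite: CannasdasilvaGuilleminPires2010, Def. 2.2 and Prop. 2.8] -/
theorem IsOrigamiForm.exists_kernelAdaptedCollar {s : MForm (𝓡 4) M ℝ 2}
    (hs : IsOrigamiForm s) (o : SmoothOrientation (𝓡 4) M) :
    ∃ (N : Type) (_ : TopologicalSpace N) (_ : ChartedSpace (EuclideanSpace ℝ (Fin 3)) N)
      (_ : IsManifold (𝓡 3) ∞ N) (_ : CompactSpace N) (j : N → M) (θ : Circle → N → N),
      (IsFoldedForm s N j ∧
        ContMDiff ((𝓡 1).prod (𝓡 3)) (𝓡 3) ∞ (fun p : Circle × N => θ p.1 p.2) ∧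
        (∀ n, θ 1 n = n) ∧ (∀ a b n, θ (a * b) n = θ a (θ b n)) ∧ (∀ a n, θ a n = n → a = 1) ∧
        (∀ (n : N) (w : TangentSpace (𝓡 4) (j n)),
          s (j n) ![mfderiv 𝓘(ℝ, ℝ) (𝓡 4) (fun t : ℝ => j (θ (Circle.exp t) n)) 0 (1 : ℝ), w] = 0)) ∧
      ∃ (f : M → ℝ) (U : LevelUnitField 3 f 0),
        IsRegularLevel (𝓡 4) f 0 ∧ f ⁻¹' {0} = fold s ∧
        {x | 0 < f x} = posSide o s ∧ {x | f x < 0} = posSide (-o) s ∧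
        (∀ x ∈ fold s, ∀ w : TangentSpace (𝓡 4) x, s x ![U.ξ x, w] = 0) ∧
        InjOn (foldCollar U j) (univ ×ˢ Ioo (-U.δ) U.δ) ∧
        foldCollar U j '' (univ ×ˢ Ioo (-U.δ) U.δ) = f ⁻¹' Ioo (-U.δ) U.δ ∧
        (∀ (n : N) (t : ℝ), t ∈ Ioo (-U.δ) U.δ → f (foldCollar U j (n, t)) = t) ∧
        (∀ (n : N) (t : ℝ), t ∈ Ioo (-U.δ) U.δ →
          Bijective (mfderiv ((𝓡 3).prod 𝓘(ℝ, ℝ)) (𝓡 4) (foldCollar U j) (n, t))) ∧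
        IsSmoothForm (s.pullback ((𝓡 3).prod 𝓘(ℝ, ℝ)) (foldCollar U j)) ∧
        IsClosedForm (s.pullback ((𝓡 3).prod 𝓘(ℝ, ℝ)) (foldCollar U j)) ∧
        (∀ (n : N) (t : ℝ), t ∈ Ioo (-U.δ) U.δ → t ≠ 0 → ∀ V : EuclideanSpace ℝ (Fin 3) × ℝ,
          V ≠ 0 → ∃ W : EuclideanSpace ℝ (Fin 3) × ℝ,
            (s.pullback ((𝓡 3).prod 𝓘(ℝ, ℝ)) (foldCollar U j)) (n, t) ![V, W] ≠ 0) ∧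
        (∀ (n : N) (W : EuclideanSpace ℝ (Fin 3) × ℝ),
          (s.pullback ((𝓡 3).prod 𝓘(ℝ, ℝ)) (foldCollar U j)) (n, 0)
            ![((0 : EuclideanSpace ℝ (Fin 3)), (1 : ℝ)), W] = 0) ∧
        (∀ (n : N) (v v' : EuclideanSpace ℝ (Fin 3)),
          (s.pullback ((𝓡 3).prod 𝓘(ℝ, ℝ)) (foldCollar U j)) (n, 0)
              ![(v, (0 : ℝ)), (v', (0 : ℝ))] =
            (s.pullback (𝓡 3) j) n ![v, v']) := by
  obtain ⟨N', i1, i2, i3, i4, j', θ, hf, hθs, hθ1, hθm, hθf, hθk⟩ := hs.exists_fold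
  obtain ⟨f, U, hrest⟩ := hf.exists_kernelAdaptedCollar o
  exact ⟨N', i1, i2, i3, i4, j', θ, ⟨hf, hθs, hθ1, hθm, hθf, hθk⟩, f, U, hrest⟩

end Literature.Geometry.Symplectic

end
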